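import Summits.QuantumFields.YangMills.Theorems.AlphaInputsT3ACv3AdaptedSelX
import HarnessLib

/-!
# `AlphaInputsT3ACv3FrozenSelection` — (n-2) THE FROZEN-SELECTION LEMMAS: measurable selectors (and measurable ENVELOPE maximisers) into a closed admissible class cut by
# a closed constraint, generic; and the instance «a measurable admissible frozen-field family `𝓥*(W)` with prescribed top datum `𝓥* k = W`» for B1 — lane `pub-balaban3d`,
# width seat alpha-2 (g7)

WHY (cell `ym3-torus`, route `UnitScaleTilt`, crux `HistoryTailL` = stmt-QuantumFields-19936; LEAD ★w1-19936 g3 B1 PLAN v1 rows (n-2); this seat's NODE-O d = 3 bill v1.1 §6 L2).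
B1 («print's regional (42)-minimiser, at ANY measurable admissible frozen-field selection, lies in `𝒞_Xs`») has to EXHIBIT the handed map `UkH k h W :=` print's minimiser at
frozen fields `𝓥*(h, W)`, so a MEASURABLE selection `W ↦ 𝓥*(W)` into the admissible frozen-field set with `𝓥* k = W` is needed; NODE O's B2∕B3 (reading D-41, «fibre-sup at each
step») will moreover need the selection MAXIMISING a continuous step exponent over the admissible set.  Both are instances of the tree's closed-class selection theorem ✓
`exists_measurable_argmin_closedClass` (`…v3AdaptedClass` §1; [AliprantisBorder2006] Thm 18.19), the engine behind ✓ `exists_selector_adaptedClassT3X`.  THIS FILE (def-free):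
* §1 GENERIC (no T³ letters): ★ `exists_measurable_selector_closedClass` (a measurable selector INTO `A(x) = {y ∈ C | (g y, π x) ∈ R}` wherever `A(x) ≠ ∅`, default elsewhere) and
  ★ `exists_measurable_envelope_closedClass` ∕ `…_of_continuousOn` (a measurable MAXIMISER of a continuous `φ` — resp. of a `φ` continuous ON the closed core `C`, via Tietze — over
  `A(x)`).
* §2 THE FROZEN-FIELD INSTANCE: `Y := (j : Fin (k+1)) → GaugeField (F.P K) j SU(2)` (levels `≤ k`; compact Polish Borel), `X := GaugeField (F.P K) k SU(2)` (the datum), the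
  constraint «top component `= W`» (closed diagonal): ★ `exists_frozenSelector (hA : IsClosed A)` and ★ `exists_frozenEnvelope (hA) (hφ : ContinuousOn φ A)` over an ABSTRACT
  closed admissible set `A` — the carrier's final admissibility predicate (`FrozenAdmissible`, LEAD ⧗p612209 ff.) then owes exactly ONE lemma, its closedness (hence: the
  `≤`-closures of `Reg7On`'s `< ε₁` and of `stepWeight`'s `< εS`, and a closed small-loop conjunct wherever `mixedDatum` reads one-step averages — `blockAvg ℰp` is continuous only
  on small loops).
HONEST FRAMING.  Measurable-selection bookkeeping; no statement of [Balaban1985UV3]∕[Balaban1985Variational] is proved; count-neutral helper toward 2′χ (`--supports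
stmt-QuantumFields-19936`); registry untouched.  YM₃ on the three-torus is rung R3 of the programme, not the Clay problem: nothing here is about d = 4, infinite volume, or a mass gap.

References: C. D. Aliprantis, K. C. Border, Infinite Dimensional Analysis, 3rd ed., Springer 2006 [AliprantisBorder2006] (Thm 18.19 p.605 measurable maximum theorem); T. Bałaban,
Commun. Math. Phys. 102 (1985) 277–309 [Balaban1985Variational] ((3), (7) p.278, Thm 1 (8) p.279); Commun. Math. Phys. 102 (1985) 255–275 [Balaban1985UV3] ((41) p.266).
-/

set_option autoImplicit false

noncomputable section

namespace Summit.QuantumFields.YangMills.Theorems.FrozenSelection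

open MeasureTheory Set Topology
open scoped Matrix.Norms.L2Operator
open Literature.MathematicalPhysics.QuantumFieldTheory.Balaban1983to89
open Literature.MathematicalPhysics.QuantumFieldTheory.Balaban1983to89.T3ContinuumYM3Torus
open Summit.QuantumFields.YangMills.Theorems.BalabanUVNodesN08AlphaGroupTopology (polishSpace_rho)
open Summit.QuantumFields.Balaban3D.Carriers (suGroupModel)

/-! ## §1 Generic: selectors and envelope maximisers over a closed class cut by a closed constraint -/

section Generic

variable {X Y Z : Type*} [MeasurableSpace X] [TopologicalSpace Y] [PolishSpace Y] [CompactSpace Y] [MeasurableSpace Y] [BorelSpace Y]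
  [TopologicalSpace Z] [MeasurableSpace Z] [OpensMeasurableSpace Z]

/-- ★ **A MEASURABLE SELECTOR INTO A CLOSED CLASS CUT BY A CLOSED CONSTRAINT.**  `Y` compact Polish (Borel), `C ⊆ Y` closed, `g : Y → Z` continuous ON `C`, `R ⊆ Z × Z` closed,
`π : X → Z` measurable: there is a measurable `f : X → Y` with `f x ∈ A(x) := {y ∈ C | (g y, π x) ∈ R}` whenever `A(x) ≠ ∅`, and `f x = y₀` otherwise
(`exists_measurable_argmin_closedClass` with the zero objective). [cite: AliprantisBorder2006, Thm 18.19 p.605] -/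
theorem exists_measurable_selector_closedClass {π : X → Z} (hπ : Measurable π) {C : Set Y} (hC : IsClosed C) {g : Y → Z}
    (hg : ContinuousOn g C) {R : Set (Z × Z)} (hR : IsClosed R) (y₀ : Y) :
    ∃ f : X → Y, Measurable f ∧
      (∀ x, {y | y ∈ C ∧ (g y, π x) ∈ R}.Nonempty → f x ∈ C ∧ (g (f x), π x) ∈ R) ∧
      (∀ x, ¬ {y | y ∈ C ∧ (g y, π x) ∈ R}.Nonempty → f x = y₀) := by
  obtain ⟨⟨f, hfm, hfin, hfout⟩, hex⟩ :=
    exists_measurable_argmin_closedClass hπ hC hg hR (S := fun _ : Y => (0 : ℝ)) continuous_const y₀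
  refine ⟨f, hfm, fun x hx => (hfin x (hex x hx)).1, fun x hx => hfout x fun ⟨y, hy, _⟩ => hx ⟨y, hy⟩⟩

/-- ★ **A MEASURABLE ENVELOPE (MAXIMISER) SELECTOR** for a CONTINUOUS `φ : Y → ℝ`: a measurable `f` with `f x ∈ A(x)` and `φ y ≤ φ (f x)` for all `y ∈ A(x)` whenever `A(x) ≠ ∅`
(`A(x)` is closed in the compact `Y`, so the maximum is attained), `f x = y₀` otherwise — `exists_measurable_argmin_closedClass` with the objective `−φ`.  The D-41 «fibre-sup»
selection of the lane's reading of (41). [cite: AliprantisBorder2006, Thm 18.19 p.605; Balaban1985UV3, (41) p.266] -/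
theorem exists_measurable_envelope_closedClass {π : X → Z} (hπ : Measurable π) {C : Set Y} (hC : IsClosed C) {g : Y → Z}
    (hg : ContinuousOn g C) {R : Set (Z × Z)} (hR : IsClosed R) {φ : Y → ℝ} (hφ : Continuous φ) (y₀ : Y) :
    ∃ f : X → Y, Measurable f ∧
      (∀ x, {y | y ∈ C ∧ (g y, π x) ∈ R}.Nonempty →
        (f x ∈ C ∧ (g (f x), π x) ∈ R) ∧ ∀ y, y ∈ C → (g y, π x) ∈ R → φ y ≤ φ (f x)) ∧
      (∀ x, ¬ {y | y ∈ C ∧ (g y, π x) ∈ R}.Nonempty → f x = y₀) := by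
  obtain ⟨⟨f, hfm, hfin, hfout⟩, hex⟩ :=
    exists_measurable_argmin_closedClass hπ hC hg hR (S := fun y : Y => -φ y) hφ.neg y₀
  refine ⟨f, hfm, fun x hx => ?_, fun x hx => hfout x fun ⟨y, hy, _⟩ => hx ⟨y, hy⟩⟩
  obtain ⟨hmem, hmin⟩ := hfin x (hex x hx)
  refine ⟨hmem, fun y hyC hyR => ?_⟩
  have h := (isMinOn_iff.mp hmin) y ⟨hyC, hyR⟩
  linarith

/-- ★ **THE ENVELOPE SELECTOR FOR A FUNCTIONAL CONTINUOUS ONLY ON THE CLOSED CORE** (e.g. an exponent reading one-step averages, continuous only on small loops): `φ` with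
`ContinuousOn φ C` is extended continuously to `Y` by Tietze (`C` closed in the compact metrizable, hence normal, `Y`), and `exists_measurable_envelope_closedClass` applies;
the maximiser property is read on `A(x) ⊆ C`, where the extension agrees with `φ`. [cite: AliprantisBorder2006, Thm 18.19 p.605] -/
theorem exists_measurable_envelope_closedClass_of_continuousOn {π : X → Z} (hπ : Measurable π) {C : Set Y} (hC : IsClosed C) {g : Y → Z}
    (hg : ContinuousOn g C) {R : Set (Z × Z)} (hR : IsClosed R) {φ : Y → ℝ} (hφ : ContinuousOn φ C) (y₀ : Y) :
    ∃ f : X → Y, Measurable f ∧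
      (∀ x, {y | y ∈ C ∧ (g y, π x) ∈ R}.Nonempty →
        (f x ∈ C ∧ (g (f x), π x) ∈ R) ∧ ∀ y, y ∈ C → (g y, π x) ∈ R → φ y ≤ φ (f x)) ∧
      (∀ x, ¬ {y | y ∈ C ∧ (g y, π x) ∈ R}.Nonempty → f x = y₀) := by
  letI : TopologicalSpace.MetrizableSpace Y := inferInstance
  letI : MetricSpace Y := TopologicalSpace.metrizableSpaceMetric Y
  haveI : NormalSpace Y := inferInstance
  -- Tietze: extend `φ|C` to a continuous function on `Y`
  let φC : C(C, ℝ) := ⟨C.restrict φ, hφ.restrict⟩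
  obtain ⟨ψ, hψ⟩ := ContinuousMap.exists_restrict_eq hC φC
  have hψφ : ∀ y ∈ C, ψ y = φ y := fun y hy => by
    have := congrArg (fun h : C(C, ℝ) => h ⟨y, hy⟩) hψ
    simpa [φC] using this
  obtain ⟨f, hfm, hfin, hfout⟩ := exists_measurable_envelope_closedClass hπ hC hg hR ψ.continuous y₀
  refine ⟨f, hfm, fun x hx => ?_, hfout⟩
  obtain ⟨hmem, hmax⟩ := hfin x hx
  refine ⟨hmem, fun y hyC hyR => ?_⟩
  have := hmax y hyC hyR
  rwa [hψφ y hyC, hψφ (f x) hmem.1] at this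

end Generic

/-! ## §2 The frozen-field instance: a measurable admissible family with prescribed top datum -/

section Frozen

variable (F : T3Family) (K k : ℕ)

variable {F K k}

/-- ★ **A MEASURABLE ADMISSIBLE FROZEN-FIELD SELECTION WITH PRESCRIBED TOP DATUM**: for every CLOSED admissible set `A` of frozen-field families of levels `≤ k` there is a
measurable `sel : (datum W) ↦ 𝓥*(W)` with `𝓥*(W) ∈ A` and `𝓥*(W) k = W` whenever some family in `A` has top component `W` (default elsewhere) — §1 at
`Y := ((j : Fin (k + 1)) → GaugeField (F.P K) j (Matrix.specialUnitaryGroup (Fin 2) ℂ))`, `X := Z := GaugeField (F.P K) k SU(2)`, `g 𝓥 := 𝓥 k`, `π := id`, `R :=` the diagonal; the datum is typed at level `↑(Fin.last k)` (definitionally `k`) so that the product's instances apply verbatim.  B1's «for every measurable admissible frozen selection» is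
thus a non-vacuous quantifier as soon as the admissible fibres are non-empty. [cite: Balaban1985Variational, (3) + (7) p.278; AliprantisBorder2006, Thm 18.19 p.605] -/
theorem exists_frozenSelector (A : Set ((j : Fin (k + 1)) → GaugeField (F.P K) j (Matrix.specialUnitaryGroup (Fin 2) ℂ))) (hA : IsClosed A) :
    ∃ sel : GaugeField (F.P K) (Fin.last k) (Matrix.specialUnitaryGroup (Fin 2) ℂ) → ((j : Fin (k + 1)) → GaugeField (F.P K) j (Matrix.specialUnitaryGroup (Fin 2) ℂ)), Measurable sel ∧
      (∀ W, (∃ 𝓥 ∈ A, 𝓥 (Fin.last k) = W) → sel W ∈ A ∧ sel W (Fin.last k) = W) ∧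
      (∀ W, ¬ (∃ 𝓥 ∈ A, 𝓥 (Fin.last k) = W) → sel W = fun _ _ => 1) := by
  haveI : PolishSpace (Matrix.specialUnitaryGroup (Fin 2) ℂ) := polishSpace_rho (suGroupModel 2)
  haveI : ∀ j : Fin (k + 1), CompactSpace (GaugeField (F.P K) j (Matrix.specialUnitaryGroup (Fin 2) ℂ)) :=
    fun j => inferInstanceAs (CompactSpace (PBond (F.P K) j → Matrix.specialUnitaryGroup (Fin 2) ℂ))
  haveI : ∀ j : Fin (k + 1), PolishSpace (GaugeField (F.P K) j (Matrix.specialUnitaryGroup (Fin 2) ℂ)) :=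
    fun j => inferInstanceAs (PolishSpace (PBond (F.P K) j → Matrix.specialUnitaryGroup (Fin 2) ℂ))
  haveI : ∀ j : Fin (k + 1), SecondCountableTopology (GaugeField (F.P K) j (Matrix.specialUnitaryGroup (Fin 2) ℂ)) :=
    fun j => inferInstanceAs (SecondCountableTopology (PBond (F.P K) j → Matrix.specialUnitaryGroup (Fin 2) ℂ))
  haveI : ∀ j : Fin (k + 1), BorelSpace (GaugeField (F.P K) j (Matrix.specialUnitaryGroup (Fin 2) ℂ)) :=
    fun j => inferInstanceAs (BorelSpace (PBond (F.P K) j → Matrix.specialUnitaryGroup (Fin 2) ℂ))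
  haveI : CompactSpace ((j : Fin (k + 1)) → GaugeField (F.P K) j (Matrix.specialUnitaryGroup (Fin 2) ℂ)) := inferInstance
  haveI : PolishSpace ((j : Fin (k + 1)) → GaugeField (F.P K) j (Matrix.specialUnitaryGroup (Fin 2) ℂ)) := inferInstance
  haveI : BorelSpace ((j : Fin (k + 1)) → GaugeField (F.P K) j (Matrix.specialUnitaryGroup (Fin 2) ℂ)) := inferInstance
  have hg : ContinuousOn (fun 𝓥 : ((j : Fin (k + 1)) → GaugeField (F.P K) j (Matrix.specialUnitaryGroup (Fin 2) ℂ)) => 𝓥 (Fin.last k)) A := (continuous_apply (Fin.last k)).continuousOn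
  have hR : IsClosed {p : GaugeField (F.P K) (Fin.last k) (Matrix.specialUnitaryGroup (Fin 2) ℂ) ×
      GaugeField (F.P K) (Fin.last k) (Matrix.specialUnitaryGroup (Fin 2) ℂ) | p.1 = p.2} :=
    isClosed_eq continuous_fst continuous_snd
  obtain ⟨f, hfm, hfin, hfout⟩ := exists_measurable_selector_closedClass (X := GaugeField (F.P K) (Fin.last k) (Matrix.specialUnitaryGroup (Fin 2) ℂ))
    (π := id) measurable_id hA hg hR (fun _ _ => 1)
  refine ⟨f, hfm, fun W hW => ?_, fun W hW => hfout W ?_⟩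
  · obtain ⟨𝓥, h𝓥A, h𝓥W⟩ := hW
    exact hfin W ⟨𝓥, h𝓥A, h𝓥W⟩
  · rintro ⟨𝓥, h𝓥A, h𝓥W⟩
    exact hW ⟨𝓥, h𝓥A, h𝓥W⟩

/-- ★ **THE MEASURABLE ENVELOPE FROZEN-FIELD SELECTION** (reading D-41, «fibre-sup at each step»): for a closed admissible set `A` and a functional `φ` continuous ON `A` (e.g. a step
exponent reading one-step averages, continuous on small loops only) there is a measurable `sel` with `sel W ∈ A`, `sel W k = W` and `φ 𝓥 ≤ φ (sel W)` for every `𝓥 ∈ A` with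
`𝓥 k = W`, whenever that fibre is non-empty. [cite: Balaban1985UV3, (41) p.266; AliprantisBorder2006, Thm 18.19 p.605] -/
theorem exists_frozenEnvelope (A : Set ((j : Fin (k + 1)) → GaugeField (F.P K) j (Matrix.specialUnitaryGroup (Fin 2) ℂ))) (hA : IsClosed A) {φ : ((j : Fin (k + 1)) → GaugeField (F.P K) j (Matrix.specialUnitaryGroup (Fin 2) ℂ)) → ℝ} (hφ : ContinuousOn φ A) :
    ∃ sel : GaugeField (F.P K) (Fin.last k) (Matrix.specialUnitaryGroup (Fin 2) ℂ) → ((j : Fin (k + 1)) → GaugeField (F.P K) j (Matrix.specialUnitaryGroup (Fin 2) ℂ)), Measurable sel ∧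
      (∀ W, (∃ 𝓥 ∈ A, 𝓥 (Fin.last k) = W) →
        (sel W ∈ A ∧ sel W (Fin.last k) = W) ∧ ∀ 𝓥 ∈ A, 𝓥 (Fin.last k) = W → φ 𝓥 ≤ φ (sel W)) ∧
      (∀ W, ¬ (∃ 𝓥 ∈ A, 𝓥 (Fin.last k) = W) → sel W = fun _ _ => 1) := by
  haveI : PolishSpace (Matrix.specialUnitaryGroup (Fin 2) ℂ) := polishSpace_rho (suGroupModel 2)
  haveI : ∀ j : Fin (k + 1), CompactSpace (GaugeField (F.P K) j (Matrix.specialUnitaryGroup (Fin 2) ℂ)) :=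
    fun j => inferInstanceAs (CompactSpace (PBond (F.P K) j → Matrix.specialUnitaryGroup (Fin 2) ℂ))
  haveI : ∀ j : Fin (k + 1), PolishSpace (GaugeField (F.P K) j (Matrix.specialUnitaryGroup (Fin 2) ℂ)) :=
    fun j => inferInstanceAs (PolishSpace (PBond (F.P K) j → Matrix.specialUnitaryGroup (Fin 2) ℂ))
  haveI : ∀ j : Fin (k + 1), SecondCountableTopology (GaugeField (F.P K) j (Matrix.specialUnitaryGroup (Fin 2) ℂ)) :=
    fun j => inferInstanceAs (SecondCountableTopology (PBond (F.P K) j → Matrix.specialUnitaryGroup (Fin 2) ℂ))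
  haveI : ∀ j : Fin (k + 1), BorelSpace (GaugeField (F.P K) j (Matrix.specialUnitaryGroup (Fin 2) ℂ)) :=
    fun j => inferInstanceAs (BorelSpace (PBond (F.P K) j → Matrix.specialUnitaryGroup (Fin 2) ℂ))
  haveI : CompactSpace ((j : Fin (k + 1)) → GaugeField (F.P K) j (Matrix.specialUnitaryGroup (Fin 2) ℂ)) := inferInstance
  haveI : PolishSpace ((j : Fin (k + 1)) → GaugeField (F.P K) j (Matrix.specialUnitaryGroup (Fin 2) ℂ)) := inferInstance
  haveI : BorelSpace ((j : Fin (k + 1)) → GaugeField (F.P K) j (Matrix.specialUnitaryGroup (Fin 2) ℂ)) := inferInstance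
  have hg : ContinuousOn (fun 𝓥 : ((j : Fin (k + 1)) → GaugeField (F.P K) j (Matrix.specialUnitaryGroup (Fin 2) ℂ)) => 𝓥 (Fin.last k)) A := (continuous_apply (Fin.last k)).continuousOn
  have hR : IsClosed {p : GaugeField (F.P K) (Fin.last k) (Matrix.specialUnitaryGroup (Fin 2) ℂ) ×
      GaugeField (F.P K) (Fin.last k) (Matrix.specialUnitaryGroup (Fin 2) ℂ) | p.1 = p.2} :=
    isClosed_eq continuous_fst continuous_snd
  obtain ⟨f, hfm, hfin, hfout⟩ := exists_measurable_envelope_closedClass_of_continuousOn (X := GaugeField (F.P K) (Fin.last k) (Matrix.specialUnitaryGroup (Fin 2) ℂ))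
    (π := id) measurable_id hA hg hR hφ (fun _ _ => 1)
  refine ⟨f, hfm, fun W hW => ?_, fun W hW => hfout W ?_⟩
  · obtain ⟨𝓥, h𝓥A, h𝓥W⟩ := hW
    obtain ⟨hmem, hmax⟩ := hfin W ⟨𝓥, h𝓥A, h𝓥W⟩
    exact ⟨hmem, fun 𝓥' h𝓥'A h𝓥'W => hmax 𝓥' h𝓥'A h𝓥'W⟩
  · rintro ⟨𝓥, h𝓥A, h𝓥W⟩
    exact hW ⟨𝓥, h𝓥A, h𝓥W⟩

end Frozen

end Summit.QuantumFields.YangMills.Theorems.FrozenSelection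

end
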